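import Literature.NumberTheory.Sieve.SmoothCompletionOfSums
import Literature.NumberTheory.Sieve.MontgomeryVaughan1975GaussSums
import HarnessLib

/-!
# Character sums against a smooth weight: `∑_m ψ_M(m) χ(m) = (M'/W) ∑_{b mod W} χ(b) + O(…)` — proved

The analytic input of §5.3.1 of S. Drappeau, *Sums of Kloosterman sums in arithmetic
progressions, and the error term in the dispersion method*, Proc. London Math. Soc. (3) 114 (2017)
684–732 = arXiv:1504.05549 (`Drappeau2017`; held as `paper:arxiv-1504.05549`, chunk 18), in the
evaluation of the dispersion sum `𝒮₃` of the proof of **Theorem 5.1**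
(`Literature.NumberTheory.Sieve.Drappeau2017_theorem51`):

"Let `W := [q₁,q₂]` and `H := W^{1+ε}/M`.  By Poisson summation (Lemma 3.1),
`∑_m α(m) χ₁χ̄₂(m) = (α̂(0)/W) ∑_{b mod W,(b,W)=1} χ₁χ̄₂(b)
  + (1/W) ∑_{0<|h|≤H} α̂(h/W) ∑_{b mod W,(b,W)=1} e(bh/W) χ₁χ̄₂(b) + O_ε(W^ε)`.
The conductor of `χ₁χ̄₂` is at most `R` [sic; at most `cond χ₁ · cond χ₂ ≤ R²`], so that
[IK, Lemma 3.2] yields `∑_{b mod W,(b,W)=1} e(bh/W) χ₁χ̄₂(b) ≪ R^{1/2} ∑_{d ∣ (h,W)} d`.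
We deduce `∑_m α(m)χ₁χ̄₂(m) = (α̂(0)/W) ∑_{b mod W,(b,W)=1} χ₁χ̄₂(b) + O_ε(W^ε R^{1/2})`."

Here this is PROVED, with explicit constants, for ANY Dirichlet character `χ mod W` (`W ≥ 1`) and
any smooth compactly supported weight `ψ` rescaled as `ψ_M(u) = ψ((u − x₀)/M)` (`M > 0`), from the
tree's completion-of-sums estimate with smooth weights (`Polymath8a.completion_truncated`,
Polymath 8a Lemma 4.9) and the Gauss-sum evaluation for imprimitive characters
(`MontgomeryVaughan1975.norm_charGauss_changeLevel_le`, Montgomery–Vaughan 1975 Lemma 5.4, which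
is [IK, Lemma 3.2] in corrected form):

* `norm_charGauss_intCast_le` — `|∑_{b mod W} χ(b) e(bh/W)| ≤ (h, W) (cond χ)^{1/2}` for `h ≠ 0`
  (from `φ(W)/φ(W/(h,W)) ≤ (h,W)`, `totient_div_totient_redMod_le`);
* `sum_Icc_gcd_le` — `∑_{1 ≤ h ≤ H} (W, h) ≤ H τ(W)`;
* `norm_tsum_smooth_mul_char_sub_le` — for `H ≥ 1`, `n ≥ 2`:
  `|∑_k ψ_M(k) χ(k) − (M'/W) ∑_{0 ≤ b < W} χ(b)|
     ≤ (M/W) (∫|ψ|) · 2 H τ(W) (cond χ)^{1/2} + W · 2 (∫|ψ⁽ⁿ⁾|) (W/(2πM))ⁿ (M/W) H^{1−n}`,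
  `M' = ∑_m ψ_M(m)` (with `H = W^{1+ε}/M` and `n` large this is the printed `O_ε(W^ε R^{1/2})`
  up to the normalisation `α̂(0) = M' + O(M^{-A})`, `Polymath8a.norm_weightSum_sub_le`);
* `changeLevel_mul_inv_apply_intCast`, `conductor_changeLevel_mul_inv_le` and
  `norm_tsum_smooth_mul_char_pair_sub_le` — the case `χ = χ₁χ̄₂` of the source: for `χⱼ mod qⱼ`,
  `W = [q₁,q₂]`, the same bound for `∑_k ψ_M(k) χ₁(k)χ̄₂(k)` with `cond χ ≤ cond χ₁ · cond χ₂`.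

## References

* S. Drappeau, Proc. London Math. Soc. (3) 114 (2017) 684–732, arXiv:1504.05549, §5.3.1.
  [Drappeau2017]
* D. H. J. Polymath, Algebra & Number Theory 8 (2014) 2067–2199, Lemma 4.9. [Polymath8a2014]
* H. L. Montgomery, R. C. Vaughan, Acta Arith. 27 (1975) 353–370, Lemma 5.4.
  [MontgomeryVaughanActa1975]
-/

noncomputable section

open Real MeasureTheory Complex Finset
open scoped FourierTransform ContDiff ArithmeticFunction.sigma

namespace Literature.NumberTheory.Sieve

namespace Drappeau2017

open MontgomeryVaughan1975 (charGauss charGauss_eq_sum norm_charGauss_changeLevel_le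
  norm_charGauss_neg redMod redMod_dvd gcd_mul_redMod sum_range_eq_sum_zmod
  fourierChar_div_eq_stdAddChar')
open Polymath8a (completion_truncated sum_Icc_neg_eq)

/-! ### The size of the Gauss sums `c_χ(h)` -/

/-- `φ(W)/φ(W/(W,m)) ≤ (W, m)` (integer division; `φ(W/(W,m)) ∣ φ(W)`). [folklore] -/
theorem totient_div_totient_redMod_le (W m : ℕ) (hW : W ≠ 0) :
    Nat.totient W / Nat.totient (redMod W m) ≤ Nat.gcd W m := by
  have hq₁ : redMod W m ≠ 0 := fun h => by
    have := gcd_mul_redMod W m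
    rw [h, mul_zero] at this
    exact hW this.symm
  -- `φ(a b) ≤ a φ(b)` (the tree's `BFI.totient_mul_le`, reproved here to keep the imports light)
  have totient_mul_le : ∀ a b : ℕ, Nat.totient (a * b) ≤ a * Nat.totient b := by
    intro a b
    induction a using Nat.recOnMul generalizing b with
    | zero => simp
    | one => simp
    | prime p hp =>
      by_cases h : p ∣ b
      · rw [Nat.totient_mul_of_prime_of_dvd hp h]
      · rw [Nat.totient_mul_of_prime_of_not_dvd hp h]
        exact Nat.mul_le_mul_right _ (Nat.sub_le p 1)
    | mul a a' ha ha' =>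
      calc Nat.totient (a * a' * b) = Nat.totient (a * (a' * b)) := by rw [mul_assoc]
        _ ≤ a * Nat.totient (a' * b) := ha _
        _ ≤ a * (a' * Nat.totient b) := Nat.mul_le_mul_left a (ha' b)
        _ = a * a' * Nat.totient b := by rw [mul_assoc]
  refine Nat.div_le_of_le_mul ?_
  calc Nat.totient W = Nat.totient (Nat.gcd W m * redMod W m) := by rw [gcd_mul_redMod]
    _ ≤ Nat.gcd W m * Nat.totient (redMod W m) := totient_mul_le _ _
    _ = Nat.totient (redMod W m) * Nat.gcd W m := mul_comm _ _

/-- **`|c_χ(m)| ≤ (W, m) (cond χ)^{1/2}`** for a character `χ mod W` and `m ≥ 1`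
(Montgomery–Vaughan 1975, Lemma 5.4, applied to the primitive character inducing `χ`).
[cite: MontgomeryVaughanActa1975, §5 Lemma 5.4] -/
theorem norm_charGauss_natCast_le {W : ℕ} [NeZero W] (χ : DirichletCharacter ℂ W) {m : ℕ}
    (hm : m ≠ 0) :
    ‖charGauss χ (m : ZMod W)‖ ≤ (Nat.gcd W m : ℝ) * Real.sqrt χ.conductor := by
  haveI : NeZero χ.conductor := ⟨χ.conductor_ne_zero⟩
  have h := norm_charGauss_changeLevel_le (q := W) χ.conductor_dvd_level
    χ.primitiveCharacter_isPrimitive hm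
  rw [DirichletCharacter.changeLevel_primitiveCharacter] at h
  refine h.trans (mul_le_mul_of_nonneg_right ?_ (Real.sqrt_nonneg _))
  have h1 : ((Nat.totient W / Nat.totient (redMod W m) : ℕ) : ℝ) ≤ (Nat.gcd W m : ℝ) := by
    exact_mod_cast totient_div_totient_redMod_le W m (NeZero.ne W)
  split_ifs
  · rw [one_mul]; exact h1
  · rw [zero_mul]; positivity

/-- `|c_χ(h)| ≤ (W, |h|) (cond χ)^{1/2}` for an integer `h ≠ 0`. [folklore] -/
theorem norm_charGauss_intCast_le {W : ℕ} [NeZero W] (χ : DirichletCharacter ℂ W) {h : ℤ}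
    (hh : h ≠ 0) :
    ‖charGauss χ (h : ZMod W)‖ ≤ (Nat.gcd W h.natAbs : ℝ) * Real.sqrt χ.conductor := by
  rcases Int.natAbs_eq h with he | he
  · rw [he, Int.cast_natCast, Int.natAbs_natCast]
    exact norm_charGauss_natCast_le χ (by omega)
  · rw [he, Int.cast_neg, Int.cast_natCast, norm_charGauss_neg, Int.natAbs_neg, Int.natAbs_natCast]
    exact norm_charGauss_natCast_le χ (by omega)

/-- **`∑_{1 ≤ h ≤ H} (W, h) ≤ H τ(W)`** (`(W,h) ≤ ∑_{d ∣ W, d ∣ h} d` and `#{h ≤ H : d ∣ h} ≤ H/d`).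
[folklore] -/
theorem sum_Icc_gcd_le (W H : ℕ) (hW : W ≠ 0) :
    ∑ h ∈ Finset.Icc 1 H, (Nat.gcd W h : ℝ) ≤ H * (σ 0 W : ℝ) := by
  have hstep : ∀ h ∈ Finset.Icc 1 H,
      (Nat.gcd W h : ℝ) ≤ ∑ d ∈ W.divisors, if d ∣ h then (d : ℝ) else 0 := by
    intro h _
    rw [← Finset.sum_filter]
    have hmem : Nat.gcd W h ∈ W.divisors.filter (fun d => d ∣ h) :=
      Finset.mem_filter.2 ⟨Nat.mem_divisors.2 ⟨Nat.gcd_dvd_left W h, hW⟩, Nat.gcd_dvd_right W h⟩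
    exact Finset.single_le_sum (f := fun d : ℕ => (d : ℝ)) (fun d _ => Nat.cast_nonneg d) hmem
  refine (Finset.sum_le_sum hstep).trans ?_
  rw [Finset.sum_comm]
  have hd : ∀ d ∈ W.divisors, ∑ h ∈ Finset.Icc 1 H, (if d ∣ h then (d : ℝ) else 0) ≤ H := by
    intro d hdW
    have hd0 : 0 < d := Nat.pos_of_mem_divisors hdW
    rw [← Finset.sum_filter, Finset.sum_const, nsmul_eq_mul]
    have hcard : ((Finset.Icc 1 H).filter (fun h => d ∣ h)).card = H / d := by
      have : Finset.Icc 1 H = Finset.Ioc 0 H := by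
        ext x; simp [Finset.mem_Icc, Finset.mem_Ioc]; omega
      rw [this]
      exact Nat.Ioc_filter_dvd_card_eq_div H d
    rw [hcard]
    calc ((H / d : ℕ) : ℝ) * d ≤ ((H : ℝ) / d) * d :=
          mul_le_mul_of_nonneg_right (Nat.cast_div_le) (Nat.cast_nonneg d)
      _ = H := by field_simp
  calc ∑ d ∈ W.divisors, ∑ h ∈ Finset.Icc 1 H, (if d ∣ h then (d : ℝ) else 0)
      ≤ ∑ d ∈ W.divisors, (H : ℝ) := Finset.sum_le_sum hd
    _ = H * (σ 0 W : ℝ) := by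
        rw [Finset.sum_const, nsmul_eq_mul, ArithmeticFunction.sigma_zero_apply, mul_comm]

/-! ### The twisted complete sums are the Gauss sums `c_χ(h)` -/

/-- `∑_{0 ≤ j < W} χ(j) e(jh/W) = c_χ(h)`. [folklore] -/
theorem sum_range_mul_fourierChar_eq_charGauss {W : ℕ} [NeZero W] (χ : DirichletCharacter ℂ W)
    (h : ℤ) :
    ∑ j ∈ Finset.range W, χ ((j : ℤ) : ZMod W) * (𝐞 (((j : ℤ) : ℝ) * h / (W : ℕ)) : ℂ) =
      charGauss χ (h : ZMod W) := by
  rw [charGauss_eq_sum, ← sum_range_eq_sum_zmod]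
  refine Finset.sum_congr rfl fun j _ => ?_
  rw [show ((j : ℤ) : ℝ) * h / (W : ℕ) = (((j : ℤ) * h : ℤ) : ℝ) / W by push_cast; ring,
    fourierChar_div_eq_stdAddChar']
  push_cast
  ring_nf

/-! ### The estimate -/

/-- **Character sums against a smooth weight** (Drappeau §5.3.1, by Poisson summation /
completion of sums and the Gauss-sum bound): for a Dirichlet character `χ mod W`, `W ≥ 1`, a smooth
compactly supported `ψ`, `M > 0`, `x₀ ∈ ℝ`, `H ≥ 1` and `n ≥ 2`,
`|∑_{k ∈ ℤ} ψ((k−x₀)/M) χ(k) − (M'/W) ∑_{0 ≤ b < W} χ(b)|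
  ≤ (M/W)(∫|ψ|) · (2 H τ(W) (cond χ)^{1/2}) + W · (2 (∫|ψ⁽ⁿ⁾|) (W/(2πM))ⁿ (M/W) H^{1−n})`,
`M' = ∑_{m ∈ ℤ} ψ((m−x₀)/M)`. [cite: Drappeau2017, §5.3.1] -/
theorem norm_tsum_smooth_mul_char_sub_le {W : ℕ} [NeZero W] (χ : DirichletCharacter ℂ W)
    {ψ : ℝ → ℂ} (hψ : ContDiff ℝ ∞ ψ) (hψc : HasCompactSupport ψ) {M : ℝ} (hM : 0 < M) (x₀ : ℝ)
    {H : ℕ} (hH : 1 ≤ H) {n : ℕ} (hn : 2 ≤ n) :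
    ‖∑' k : ℤ, ψ ((k - x₀) / M) * χ ((k : ℤ) : ZMod W) -
        (∑' m : ℤ, ψ ((m - x₀) / M)) / (W : ℂ) * ∑ j ∈ Finset.range W, χ ((j : ℤ) : ZMod W)‖ ≤
      M / W * (∫ t, ‖ψ t‖) * (2 * H * (σ 0 W : ℝ) * Real.sqrt χ.conductor) +
        W * (2 * (∫ t, ‖iteratedDeriv n ψ t‖) * ((W : ℝ) / (2 * π * M)) ^ n * (M / W) *
          ((H : ℝ) ^ (n - 1))⁻¹) := by
  have hW : 0 < W := Nat.pos_of_ne_zero (NeZero.ne W)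
  have hper : ∀ m k : ℤ, (fun m : ℤ => χ ((m : ℤ) : ZMod W)) (m + W * k) =
      (fun m : ℤ => χ ((m : ℤ) : ZMod W)) m := by
    intro m k
    simp only
    push_cast
    rw [ZMod.natCast_self, zero_mul, add_zero]
  have h := completion_truncated hψ hψc hM x₀ Nat.one_pos hW 0
    (g := fun m : ℤ => χ ((m : ℤ) : ZMod W)) hper hH hn
  simp only [Nat.cast_one, Int.cast_zero, zero_add, one_mul] at h
  refine h.trans (add_le_add ?_ ?_)
  · -- the twisted complete sums
    refine mul_le_mul_of_nonneg_left ?_ (by positivity)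
    have hT : ∀ k : ℤ, ∑ j ∈ Finset.range W,
        χ ((j : ℤ) : ZMod W) * (𝐞 (((j : ℤ) : ℝ) * k / (W : ℕ)) : ℂ) =
        charGauss χ (k : ZMod W) := fun k => sum_range_mul_fourierChar_eq_charGauss χ k
    simp only [hT]
    rw [Finset.sum_filter, sum_Icc_neg_eq]
    simp only [dvd_zero, not_true, if_false, zero_add]
    calc ∑ ν ∈ Finset.Icc 1 H, ((if ¬ ((W : ℕ) : ℤ) ∣ (ν : ℤ) then ‖charGauss χ ((ν : ℤ) : ZMod W)‖
            else 0) + (if ¬ ((W : ℕ) : ℤ) ∣ -(ν : ℤ) then ‖charGauss χ ((-(ν : ℤ) : ℤ) : ZMod W)‖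
            else 0))
        ≤ ∑ ν ∈ Finset.Icc 1 H, 2 * ((Nat.gcd W ν : ℝ) * Real.sqrt χ.conductor) := by
          refine Finset.sum_le_sum fun ν hν => ?_
          have hν0 : (ν : ℤ) ≠ 0 := by
            have := (Finset.mem_Icc.1 hν).1
            omega
          have b1 := norm_charGauss_intCast_le χ hν0
          have b2 := norm_charGauss_intCast_le χ (neg_ne_zero.2 hν0)
          rw [Int.natAbs_neg] at b2
          rw [Int.natAbs_natCast] at b1 b2
          have g0 : 0 ≤ (Nat.gcd W ν : ℝ) * Real.sqrt χ.conductor := by positivity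
          split_ifs <;> push_cast at b1 b2 ⊢ <;> linarith
      _ = 2 * Real.sqrt χ.conductor * ∑ ν ∈ Finset.Icc 1 H, (Nat.gcd W ν : ℝ) := by
          rw [Finset.mul_sum]
          refine Finset.sum_congr rfl fun ν _ => ?_
          ring
      _ ≤ 2 * Real.sqrt χ.conductor * (H * (σ 0 W : ℝ)) :=
          mul_le_mul_of_nonneg_left (sum_Icc_gcd_le W H (NeZero.ne W)) (by positivity)
      _ = 2 * H * (σ 0 W : ℝ) * Real.sqrt χ.conductor := by ring
  · -- the complete sum of `|χ|`
    refine mul_le_mul_of_nonneg_right ?_ ?_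
    · calc ∑ j ∈ Finset.range W, ‖χ ((j : ℤ) : ZMod W)‖ ≤ ∑ j ∈ Finset.range W, (1 : ℝ) :=
            Finset.sum_le_sum fun j _ => DirichletCharacter.norm_le_one χ _
        _ = W := by simp
    · have : 0 ≤ ∫ t, ‖iteratedDeriv n ψ t‖ := integral_nonneg fun _ => norm_nonneg _
      positivity

/-! ### The product character `χ₁ χ̄₂ mod [q₁,q₂]` -/

/-- The character `χ₁χ̄₂ mod [q₁,q₂]` evaluated at integers:
`(χ₁χ̄₂)(k) = χ₁(k) χ̄₂(k)` (`χ̄ = χ⁻¹` on values; both sides vanish unless `(k, [q₁,q₂]) = 1`).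
[cite: Drappeau2017, §5.3.1] -/
theorem changeLevel_mul_inv_apply_intCast {q₁ q₂ : ℕ} [NeZero (Nat.lcm q₁ q₂)]
    (χ₁ : DirichletCharacter ℂ q₁) (χ₂ : DirichletCharacter ℂ q₂) (k : ℤ) :
    (DirichletCharacter.changeLevel (Nat.dvd_lcm_left q₁ q₂) χ₁ *
        (DirichletCharacter.changeLevel (Nat.dvd_lcm_right q₁ q₂) χ₂)⁻¹) ((k : ℤ) : ZMod (Nat.lcm q₁ q₂)) =
      χ₁ ((k : ℤ) : ZMod q₁) * (χ₂ ((k : ℤ) : ZMod q₂))⁻¹ := by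
  rw [MulChar.coeToFun_mul, Pi.mul_apply, MulChar.inv_apply_eq_inv']
  by_cases hk : IsCoprime k (Nat.lcm q₁ q₂)
  · rw [DirichletCharacter.changeLevel_eq_cast_of_dvd' χ₁ _ hk,
      DirichletCharacter.changeLevel_eq_cast_of_dvd' χ₂ _ hk]
  · have hku : ¬ IsUnit ((k : ℤ) : ZMod (Nat.lcm q₁ q₂)) := fun hu =>
      hk ((ZMod.coe_int_isUnit_iff_isCoprime k _).1 hu).symm
    rw [MulChar.map_nonunit _ hku, zero_mul]
    -- `k` is not coprime to `q₁` or to `q₂`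
    by_cases h₁ : IsCoprime k q₁
    · have h₂ : ¬ IsCoprime k q₂ := fun h₂ => hk (by
        have h12 : IsCoprime k ((q₁ : ℤ) * q₂) := IsCoprime.mul_right h₁ h₂
        exact h12.of_isCoprime_of_dvd_right (by exact_mod_cast Nat.lcm_dvd_mul q₁ q₂))
      rw [MulChar.map_nonunit χ₂ (fun hu => h₂ ((ZMod.coe_int_isUnit_iff_isCoprime k _).1 hu).symm),
        inv_zero, mul_zero]
    · rw [MulChar.map_nonunit χ₁ (fun hu => h₁ ((ZMod.coe_int_isUnit_iff_isCoprime k _).1 hu).symm),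
        zero_mul]

/-- `cond(χ₁χ̄₂ mod [q₁,q₂]) ≤ cond χ₁ · cond χ₂`: `χ₁χ̄₂` is induced from level `[cond χ₁, cond χ₂]`
(the source states "at most `R`" for `χⱼ ∈ 𝒳_{qⱼ}(R)`; `R²` is what holds in general).
[cite: Drappeau2017, §5.3.1] -/
theorem conductor_changeLevel_mul_inv_le {q₁ q₂ : ℕ} [NeZero (Nat.lcm q₁ q₂)]
    (χ₁ : DirichletCharacter ℂ q₁) (χ₂ : DirichletCharacter ℂ q₂) :
    (DirichletCharacter.changeLevel (Nat.dvd_lcm_left q₁ q₂) χ₁ *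
        (DirichletCharacter.changeLevel (Nat.dvd_lcm_right q₁ q₂) χ₂)⁻¹).conductor ≤
      χ₁.conductor * χ₂.conductor := by
  set L := Nat.lcm q₁ q₂ with hL
  have hq₁ : q₁ ≠ 0 := fun h => NeZero.ne L (by rw [hL, h, Nat.lcm_zero_left])
  have hq₂ : q₂ ≠ 0 := fun h => NeZero.ne L (by rw [hL, h, Nat.lcm_zero_right])
  haveI : NeZero q₁ := ⟨hq₁⟩
  haveI : NeZero q₂ := ⟨hq₂⟩
  set c₁ := χ₁.conductor with hc₁
  set c₂ := χ₂.conductor with hc₂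
  have hc₁q : c₁ ∣ q₁ := χ₁.conductor_dvd_level
  have hc₂q : c₂ ∣ q₂ := χ₂.conductor_dvd_level
  have hc₁L : c₁ ∣ L := hc₁q.trans (Nat.dvd_lcm_left q₁ q₂)
  have hc₂L : c₂ ∣ L := hc₂q.trans (Nat.dvd_lcm_right q₁ q₂)
  have hcL : Nat.lcm c₁ c₂ ∣ L := Nat.lcm_dvd hc₁L hc₂L
  have hc₁0 : c₁ ≠ 0 := χ₁.conductor_ne_zero
  have hc₂0 : c₂ ≠ 0 := χ₂.conductor_ne_zero
  -- `χ₁χ̄₂` factors through `[c₁, c₂]`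
  set χ₀ : DirichletCharacter ℂ (Nat.lcm c₁ c₂) :=
    DirichletCharacter.changeLevel (Nat.dvd_lcm_left c₁ c₂) χ₁.primitiveCharacter *
      (DirichletCharacter.changeLevel (Nat.dvd_lcm_right c₁ c₂) χ₂.primitiveCharacter)⁻¹ with hχ₀
  have hfac : DirichletCharacter.changeLevel (Nat.dvd_lcm_left q₁ q₂) χ₁ *
      (DirichletCharacter.changeLevel (Nat.dvd_lcm_right q₁ q₂) χ₂)⁻¹ =
      DirichletCharacter.changeLevel hcL χ₀ := by
    rw [hχ₀, map_mul, map_inv, ← DirichletCharacter.changeLevel_trans,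
      ← DirichletCharacter.changeLevel_trans]
    conv_lhs => rw [← DirichletCharacter.changeLevel_primitiveCharacter χ₁,
      ← DirichletCharacter.changeLevel_primitiveCharacter χ₂,
      ← DirichletCharacter.changeLevel_trans, ← DirichletCharacter.changeLevel_trans]
  have hmem : Nat.lcm c₁ c₂ ∈ DirichletCharacter.conductorSet
      (DirichletCharacter.changeLevel (Nat.dvd_lcm_left q₁ q₂) χ₁ *
        (DirichletCharacter.changeLevel (Nat.dvd_lcm_right q₁ q₂) χ₂)⁻¹) :=
    (DirichletCharacter.mem_conductorSet_iff _).2 ⟨hcL, χ₀, hfac⟩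
  refine (Nat.le_of_dvd (Nat.pos_of_ne_zero (Nat.lcm_ne_zero hc₁0 hc₂0))
    (DirichletCharacter.conductor_dvd_of_mem_conductorSet _ hmem)).trans ?_
  exact Nat.le_of_dvd (Nat.pos_of_ne_zero (mul_ne_zero hc₁0 hc₂0)) (Nat.lcm_dvd_mul c₁ c₂)

/-- **The character sums of §5.3.1 against a smooth weight**: for `χⱼ mod qⱼ` (`qⱼ ≥ 1`),
`W = [q₁,q₂]`, a smooth compactly supported `ψ`, `M > 0`, `x₀`, `H ≥ 1`, `n ≥ 2`,
`|∑_{k ∈ ℤ} ψ((k−x₀)/M) χ₁(k)χ̄₂(k) − (M'/W) ∑_{0 ≤ b < W} χ₁(b)χ̄₂(b)|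
  ≤ (M/W)(∫|ψ|) · 2 H τ(W) (cond χ₁ cond χ₂)^{1/2} + W · 2 (∫|ψ⁽ⁿ⁾|) (W/(2πM))ⁿ (M/W) H^{1−n}`
("By Poisson summation … `≪ R^{1/2} ∑_{d∣(h,W)} d` … We deduce
`∑_m α(m)χ₁χ̄₂(m) = (α̂(0)/W)∑_{b} χ₁χ̄₂(b) + O_ε(W^ε R^{1/2})`").
[cite: Drappeau2017, §5.3.1] -/
theorem norm_tsum_smooth_mul_char_pair_sub_le {q₁ q₂ : ℕ} [NeZero (Nat.lcm q₁ q₂)]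
    (χ₁ : DirichletCharacter ℂ q₁) (χ₂ : DirichletCharacter ℂ q₂)
    {ψ : ℝ → ℂ} (hψ : ContDiff ℝ ∞ ψ) (hψc : HasCompactSupport ψ) {M : ℝ} (hM : 0 < M) (x₀ : ℝ)
    {H : ℕ} (hH : 1 ≤ H) {n : ℕ} (hn : 2 ≤ n) :
    ‖∑' k : ℤ, ψ ((k - x₀) / M) * (χ₁ ((k : ℤ) : ZMod q₁) * (χ₂ ((k : ℤ) : ZMod q₂))⁻¹) -
        (∑' m : ℤ, ψ ((m - x₀) / M)) / (Nat.lcm q₁ q₂ : ℂ) *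
          ∑ j ∈ Finset.range (Nat.lcm q₁ q₂),
            χ₁ ((j : ℤ) : ZMod q₁) * (χ₂ ((j : ℤ) : ZMod q₂))⁻¹‖ ≤
      M / (Nat.lcm q₁ q₂) * (∫ t, ‖ψ t‖) *
          (2 * H * (σ 0 (Nat.lcm q₁ q₂) : ℝ) * Real.sqrt (χ₁.conductor * χ₂.conductor)) +
        (Nat.lcm q₁ q₂) * (2 * (∫ t, ‖iteratedDeriv n ψ t‖) *
          ((Nat.lcm q₁ q₂ : ℝ) / (2 * π * M)) ^ n * (M / (Nat.lcm q₁ q₂)) *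
          ((H : ℝ) ^ (n - 1))⁻¹) := by
  set χ := DirichletCharacter.changeLevel (Nat.dvd_lcm_left q₁ q₂) χ₁ *
    (DirichletCharacter.changeLevel (Nat.dvd_lcm_right q₁ q₂) χ₂)⁻¹ with hχ
  have h := norm_tsum_smooth_mul_char_sub_le χ hψ hψc hM x₀ hH hn
  simp only [hχ, changeLevel_mul_inv_apply_intCast] at h
  refine h.trans (add_le_add (mul_le_mul_of_nonneg_left (mul_le_mul_of_nonneg_left
    (Real.sqrt_le_sqrt ?_) (by positivity)) (by positivity)) le_rfl)
  exact_mod_cast conductor_changeLevel_mul_inv_le χ₁ χ₂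

end Drappeau2017

end Literature.NumberTheory.Sieve

end
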